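import Literature.AlgebraicGeometry.Frobenioids.BaseCategoryTheoreticityDefs
import HarnessLib

/-!
# Frobenioids I, §4 "Category-theoreticity of the divisor monoid": Proposition 4.1, Theorem 4.2,
# Proposition 4.4 (the birationalization, INTERFACE), Definition 4.5, Remark 4.5.1, Example 4.7 (i),
# Proposition 4.8

Mochizuki, *The geometry of Frobenioids I: the general theory*, Kyushu J. Math. **62** (2008)
293–400, kurims text pp. 75–88 [cite: MochizukiFrdI2008, §4 pp.75-88]. Standing data of §4 (p. 75): a
divisorial monoid `Φ` on a connected, totally epimorphic `D` and a Frobenioid `C → F_Φ`, here through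
its operations `S : PreFrobenioidData C D` (INTERFACE, `TODO-merge: abc-iut-found`); as in the §3 files
every sub-item is a *conclusion predicate* asserted in print for all Frobenioids (plus the printed extra
hypotheses, which ARE part of the predicate when they are Def. 1.2 notions). Two printed hypotheses are
§2 notions owned by seat abc-iut-L1-t2 and enter as parameters with their locator: "`Φ` is
perf-factorial" and the support `Supp(a)` of Def. 2.4 (i); so does "pre-model type" (Def. 2.7).

Contents: Prop. 4.1 (i)–(v) (with "co-primary" DEFINED by its categorical condition, (iii)); Thm. 4.2
(i)–(iii); Prop. 4.4: the birationalization `C^birat` needs Prop. 4.4 (i) itself (composition on the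
inductive limits `Hom^birat`) to be a category, so it is recorded as an INTERFACE `BiratData` (category,
functor `C → C^birat`, its Frobenioid structure over the ZERO monoid `0_D` (Prop. 4.4 (ii)) and, separately, the subgroups `Φ^birat ⊆ Φ^gp` with the divisor maps `O^×(A^birat) → Φ^birat` of (iii)), over which (i)–(iv) are typed;
Def. 4.5 (i)–(iv) ((iv) Div-slim DEFINED, "slim ⇒ Div-slim" PROVED); Rem. 4.5.1; Ex. 4.7 (i) first claim
PROVED; Prop. 4.8 (i)–(iv). Not here: Ex. 4.3, 4.6, 4.7 (ii) (explicit monoid/category constructions;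
separate examples file). No statement of the paper is strengthened.
-/

namespace Literature.AlgebraicGeometry.Frobenioids

open CategoryTheory

universe w w₁ w₂ v v' v₁ v₁' v₂ v₂' u u' u₁ u₁' u₂ u₂' vb

namespace PreFrobenioidData

section OneFrobenioid

variable {C : Type u} [Category.{v} C] {D : Type u'} [Category.{v'} D]
variable (S : PreFrobenioidData.{w} C D)

/-! ### Proposition 4.1 (Primary steps) -/

/-- The data fixed in Prop. 4.1: `C` of perfect and isotropic type, `A` Div-Frobenius-trivial, and for
each `n ∈ N_{≥1}` a Div-identity endomorphism `α_n` of `A` of Frobenius type and degree `n` (FrdI p. 75;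
the hypothesis "`Φ` perf-factorial", Def. 2.4 (i), is a §2 notion and is added by the wrapper).
[cite: MochizukiFrdI2008, Prop. 4.1 p.75] -/
@[mk_iff] structure Prop41Setting (A : C) (α : ℕ+ → End A) : Prop where
  /-- `C` of perfect type -/
  perfect : S.IsOfPerfectType
  /-- `C` of isotropic type -/
  isotropic : S.IsOfIsotropicType
  /-- `A` is Div-Frobenius-trivial -/
  divFrobTrivial : S.IsDivFrobeniusTrivial A
  /-- `α_n` is a Div-identity endomorphism of Frobenius type of degree `n` -/
  alpha : ∀ n, S.IsDivIdentity (α n) ∧ S.IsFrobeniusType (α n) ∧ S.degFr (α n) = n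

/-- **Proposition 4.1 (i)**: a step `φ : B → A` is primary iff for every factorisation `φ = φ_A ∘ φ_B`
into steps `φ_B : B → B'`, `φ_A : B' → A` there are `n`, a morphism of Frobenius type `β' : B' → B''` and a
pre-step `ζ' : B'' → B` with `α_n ∘ φ_A = (φ ∘ ζ') ∘ β'` (FrdI p. 75). [cite: MochizukiFrdI2008, Prop. 4.1 (i) p.75] -/
def Prop41i (A : C) (α : ℕ+ → End A) : Prop :=
  S.Prop41Setting A α → ∀ ⦃B : C⦄ (φ : B ⟶ A), S.IsStep φ →
    (S.IsPrimaryPreStep φ ↔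
      ∀ ⦃B' : C⦄ (φB : B ⟶ B') (φA : B' ⟶ A), S.IsStep φB → S.IsStep φA → φB ≫ φA = φ →
        ∃ (n : ℕ+) (B'' : C) (β' : B' ⟶ B'') (ζ' : B'' ⟶ B),
          S.IsFrobeniusType β' ∧ S.IsPreStep ζ' ∧ φA ≫ (α n : A ⟶ A) = β' ≫ ζ' ≫ φ)

/-- **Proposition 4.1 (ii)**: for `φ : B → A` primary and a step `ψ : A → C`, the composite `ψ ∘ φ` (hence
`ψ`) is primary iff every factorisation `ψ ∘ φ = ψ' ∘ φ'` into steps admits factorizations `φ = ζ ∘ φ''`,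
`φ' = ζ' ∘ φ''` with `φ''` a step and `ζ, ζ'` pre-steps (FrdI p. 75). [cite: MochizukiFrdI2008, Prop. 4.1 (ii) p.75] -/
def Prop41ii (A : C) (α : ℕ+ → End A) : Prop :=
  S.Prop41Setting A α → ∀ ⦃B C' : C⦄ (φ : B ⟶ A) (ψ : A ⟶ C'), S.IsStep φ → S.IsPrimaryPreStep φ →
    S.IsStep ψ →
      ((S.IsPrimaryPreStep (φ ≫ ψ) ∧ S.IsPrimaryPreStep ψ) ↔
        ∀ ⦃A' : C⦄ (φ' : B ⟶ A') (ψ' : A' ⟶ C'), S.IsStep φ' → S.IsStep ψ' → φ' ≫ ψ' = φ ≫ ψ →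
          ∃ (A'' : C) (φ'' : B ⟶ A'') (ζ : A'' ⟶ A) (ζ' : A'' ⟶ A'),
            S.IsStep φ'' ∧ S.IsPreStep ζ ∧ S.IsPreStep ζ' ∧ φ'' ≫ ζ = φ ∧ φ'' ≫ ζ' = φ')

/-- Steps `ε : E → F`, `ι : I → F` are *co-primary* if every pre-step `ζ : Z → F` through which both
factor by pre-steps is an isomorphism (FrdI Prop. 4.1 (iii) p. 75, "In this case, we shall say that
`ε`, `ι` are co-primary"). [cite: MochizukiFrdI2008, Prop. 4.1 (iii) p.75] -/
def IsCoprimary {E I F : C} (ε : E ⟶ F) (ι : I ⟶ F) : Prop :=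
  ∀ ⦃Z : C⦄ (ζ : Z ⟶ F), S.IsPreStep ζ →
    (∃ (ε' : E ⟶ Z) (ι' : I ⟶ Z), S.IsPreStep ε' ∧ S.IsPreStep ι' ∧ ε' ≫ ζ = ε ∧ ι' ≫ ζ = ι) → IsIso ζ

/-- **Proposition 4.1 (iii)**, criterion: `ε_*(Div ε)`, `ι_*(Div ι) ∈ Φ(F)` have disjoint supports iff
`ε`, `ι` are co-primary (FrdI p. 75). The support `Supp` of Def. 2.4 (i)(d) is a §2 notion (seat
abc-iut-L1-t2) and enters as the parameter `DisjointSupp` on `Φ(F)`; `ε_*` is the bijection inverse to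
`Base(ε)^*`, so "`ε_*(Div ε) = y`" reads `Base(ε)^* y = Div ε`. [cite: MochizukiFrdI2008, Prop. 4.1 (iii) p.75] -/
def Prop41iii_criterion (DisjointSupp : ∀ {X : D}, S.Mon X → S.Mon X → Prop) : Prop :=
  S.IsOfPerfectType → S.IsOfIsotropicType → ∀ ⦃E I F : C⦄ (ε : E ⟶ F) (ι : I ⟶ F), S.IsStep ε → S.IsStep ι →
    ∀ (yε yι : S.Mon (S.base.obj F)), S.pull (S.base.map ε) yε = S.div ε → S.pull (S.base.map ι) yι = S.div ι →
      (DisjointSupp yε yι ↔ S.IsCoprimary ε ι)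

/-- **Proposition 4.1 (iii)**, cartesian square: co-primary steps `ε`, `ι` admit a cartesian square of
pre-steps `ε' : U → E`, `ι' : U → I` (`ε ∘ ε' = ι ∘ ι'`, cartesian in the category of pre-steps) with
`ε_* ε'_*(Div ε') = ι_*(Div ι)`, `ι_* ι'_*(Div ι') = ε_*(Div ε)`; if `ε, ι` are primary so are `ε', ι'`
(FrdI pp. 75–76). [cite: MochizukiFrdI2008, Prop. 4.1 (iii) p.75] -/
def Prop41iii_square : Prop :=
  S.IsOfPerfectType → S.IsOfIsotropicType → ∀ ⦃E I F : C⦄ (ε : E ⟶ F) (ι : I ⟶ F), S.IsStep ε → S.IsStep ι →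
    S.IsCoprimary ε ι →
      ∃ (U : C) (ε' : U ⟶ E) (ι' : U ⟶ I), S.IsPreStep ε' ∧ S.IsPreStep ι' ∧ ε' ≫ ε = ι' ≫ ι ∧
        -- cartesian among pre-steps
        (∀ ⦃V : C⦄ (a : V ⟶ E) (b : V ⟶ I), S.IsPreStep a → S.IsPreStep b → a ≫ ε = b ≫ ι →
            ∃! u : V ⟶ U, u ≫ ε' = a ∧ u ≫ ι' = b) ∧
        -- the divisor identities, through `Base(-)^*`
        (∀ yι : S.Mon (S.base.obj F), S.pull (S.base.map ι) yι = S.div ι →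
            S.pull (S.base.map (ε' ≫ ε)) yι = S.div ε') ∧
        (∀ yε : S.Mon (S.base.obj F), S.pull (S.base.map ε) yε = S.div ε →
            S.pull (S.base.map (ι' ≫ ι)) yε = S.div ι') ∧
        (S.IsPrimaryPreStep ε → S.IsPrimaryPreStep ι → S.IsPrimaryPreStep ε' ∧ S.IsPrimaryPreStep ι')

/-- **Proposition 4.1 (iv)**: a step `δ : D' → E` is primary iff there is a prime `𝔭 ∈ Prime(Φ(F))` such
that for every primary `ε' : E' → F` with `ε'_*(Div ε') ∉ 𝔭`: `ε` factors as `ε' ∘ ζ` (`ζ` a pre-step) iff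
`ε ∘ δ` factors as `ε' ∘ θ` (`θ` a pre-step) (FrdI p. 76). [cite: MochizukiFrdI2008, Prop. 4.1 (iv) p.76] -/
def Prop41iv : Prop :=
  S.IsOfPerfectType → S.IsOfIsotropicType → ∀ ⦃D' E F : C⦄ (δ : D' ⟶ E) (ε : E ⟶ F), S.IsStep δ → S.IsStep ε →
    (S.IsPrimaryPreStep δ ↔
      ∃ 𝔭 : Primes (S.Mon (S.base.obj F)), ∀ ⦃E' : C⦄ (ε' : E' ⟶ F), S.IsStep ε' → S.IsPrimaryPreStep ε' →
        (∃ y, S.pull (S.base.map ε') y = S.div ε' ∧ y ∉ 𝔭.carrier) →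
          ((∃ ζ : E ⟶ E', S.IsPreStep ζ ∧ ζ ≫ ε' = ε) ↔
            ∃ θ : D' ⟶ E', S.IsPreStep θ ∧ θ ≫ ε' = δ ≫ ε))

/-- **Proposition 4.1 (v)**: a step `ε : E → F` is primary iff there is a prime `𝔭 ∈ Prime(Φ(D'))` such
that for every primary `δ' : D' → E'` with `Div δ' ∉ 𝔭`: `δ` factors as `ζ ∘ δ'` iff `ε ∘ δ` factors as
`θ ∘ δ'` (`ζ, θ` pre-steps) (FrdI p. 76). [cite: MochizukiFrdI2008, Prop. 4.1 (v) p.76] -/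
def Prop41v : Prop :=
  S.IsOfPerfectType → S.IsOfIsotropicType → ∀ ⦃D' E F : C⦄ (δ : D' ⟶ E) (ε : E ⟶ F), S.IsStep δ → S.IsStep ε →
    (S.IsPrimaryPreStep ε ↔
      ∃ 𝔭 : Primes (S.Mon (S.base.obj D')), ∀ ⦃E' : C⦄ (δ' : D' ⟶ E'), S.IsStep δ' →
        S.IsPrimaryPreStep δ' → S.div δ' ∉ 𝔭.carrier →
          ((∃ ζ : E' ⟶ E, S.IsPreStep ζ ∧ δ' ≫ ζ = δ) ↔
            ∃ θ : E' ⟶ F, S.IsPreStep θ ∧ δ' ≫ θ = δ ≫ ε))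

/-! ### Proposition 4.4: the birationalization (INTERFACE) and Definition 4.5 -/

/-- INTERFACE for the *birationalization* `C^birat` of FrdI Prop. 4.4 (pp. 82–83): the category with the
objects of `C` and `Hom^birat_C(A, B) = colim_{(A' → A) ∈ C^coa-pre_A} Hom_C(A', B)` (composition by
Prop. 4.4 (i)), the natural functor `C → C^birat`, its Frobenioid structure "determined by the functor
`C^birat → F_{0_D}`" (Prop. 4.4 (ii): of group-like type — so the operations `ops` are over the ZERO monoid
`0_D`), and, separately, the *rational function monoid* data of (ii)–(iii): the subgroups
`Φ^birat(X) ⊆ Φ^gp(X)` and the divisor maps `O^×(A^birat) → Φ^birat(Base A)`. Since already the category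
structure is the content of (i), the construction is not repeated here; statements over a `BiratData`
are faithful when it is instantiated with THE birationalization (a data-only interface admits junk
instances — never quantify universally over it). [cite: MochizukiFrdI2008, Prop. 4.4 p.82] -/
structure BiratData where
  /-- the category `C^birat` -/
  Birat : Type u
  [catBirat : Category.{vb} Birat]
  /-- the natural functor `C → C^birat` (identity on objects) -/
  toBirat : C ⥤ Birat
  /-- every object of `C^birat` is the image of an object of `C` -/
  obj_surjective : Function.Surjective toBirat.obj
  /-- the Frobenioid structure `C^birat → F_{0_D}` of Prop. 4.4 (ii), as operations over the same base `D` -/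
  ops : PreFrobenioidData.{w} Birat D
  /-- the divisor monoid of `ops` is the zero monoid `0_D` -/
  ops_mon_eq_one : ∀ (X : D) (x : ops.Mon X), x = 1
  /-- `C → C^birat` lies over `D` -/
  overBase : toBirat ⋙ ops.base ≅ S.base
  /-- `Φ^birat(X) ⊆ Φ^gp(X)`, the rational function monoid (Prop. 4.4 (ii)–(iii)) -/
  phiBirat : ∀ X : D, Subgroup (Algebra.GrothendieckGroup (S.Mon X))
  /-- the divisor `O^×(A^birat) → Φ(Base A)^gp` of a unit of `A^birat` (Prop. 4.4 (iii)) … -/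
  divBirat : ∀ A : C, ops.unitsSubgroup (toBirat.obj A) →* Algebra.GrothendieckGroup (S.Mon (S.base.obj A))
  /-- … with values in `Φ^birat(Base A)` -/
  divBirat_mem : ∀ (A : C) (u : ops.unitsSubgroup (toBirat.obj A)), divBirat A u ∈ phiBirat (S.base.obj A)

/-- `C^birat` is a category (structure-carried instance, exposed). [cite: MochizukiFrdI2008, Prop. 4.4 p.82] -/
instance BiratData.instCategoryBirat (B : S.BiratData) : Category B.Birat := B.catBirat

variable {S} (B : S.BiratData)

/-- **Proposition 4.4 (i)** (typed over the interface): `C → C^birat` lies over `D` and preserves Frobenius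
degrees — the 1-commutative diagram `C → F_Φ`, `C^birat → F_{Φ^gp} → F_{0_D}` (FrdI p. 83).
[cite: MochizukiFrdI2008, Prop. 4.4 (i) p.83] -/
def Prop44i : Prop :=
  Nonempty (B.toBirat ⋙ B.ops.base ≅ S.base) ∧ ∀ ⦃A A' : C⦄ (φ : A ⟶ A'), B.ops.degFr (B.toBirat.map φ) = S.degFr φ

/-- **Proposition 4.4 (ii)**: `C^birat → F_{0_D}` is (a Frobenioid structure) of group-like type; `C → C^birat`
is faithful; it carries `O^▷(A)` into `O^×(A^birat)` ("an injection of groups `O^▷(A)^gp ↪ O^×(A^birat)`")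
(FrdI p. 83). [cite: MochizukiFrdI2008, Prop. 4.4 (ii) p.83] -/
def Prop44ii : Prop :=
  B.ops.IsOfGroupLikeType ∧ B.toBirat.Faithful ∧
    ∀ (A : C) (α : End A), α ∈ S.endSubmonoid A →
      IsIso (B.toBirat.map α) ∧ B.ops.IsBaseIdentity (B.toBirat.map α) ∧ B.ops.IsLinear (B.toBirat.map α)

/-- **Proposition 4.4 (iii)**: the divisor map `O^×(A^birat) → Φ^birat(Base A)` is surjective and its kernel
is the image of `O^×(A)` (the exact sequence `1 → O^×(A) → O^×(A^birat) → Φ^birat(A) → 1`, FrdI p. 83).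
[cite: MochizukiFrdI2008, Prop. 4.4 (iii) p.83] -/
def Prop44iii : Prop :=
  ∀ A : C,
    (∀ y ∈ B.phiBirat (S.base.obj A), ∃ u, B.divBirat A u = y) ∧
    ∀ u : B.ops.unitsSubgroup (B.toBirat.obj A), B.divBirat A u = 1 ↔
      ∃ α : Aut A, α ∈ S.unitsSubgroup A ∧ B.toBirat.mapIso α = (u : Aut (B.toBirat.obj A))

/-- **Proposition 4.4 (iv)**: the dictionary of classes of arrows along `C → C^birat`: co-angular ↦
co-angular; co-angular pre-step ↦ isomorphism; co-angular base-isomorphism ↦ Frobenius type; co-angular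
linear ↦ pull-back; degrees preserved; every arrow ↦ isometry; pre-step ↦ pre-step; base-iso ↦ base-iso;
isotropic objects ↦ isotropic objects — the printed "iff"s in the image direction (FrdI p. 83).
[cite: MochizukiFrdI2008, Prop. 4.4 (iv) p.83] -/
def Prop44iv : Prop :=
  PreservesMor B.toBirat S.IsCoAngular B.ops.IsCoAngular ∧
    (∀ ⦃A A' : C⦄ (φ : A ⟶ A'), S.IsCoAngularPreStep φ → IsIso (B.toBirat.map φ)) ∧
    PreservesMor B.toBirat (fun _ _ φ => S.IsCoAngular φ ∧ S.IsBaseIso φ) B.ops.IsFrobeniusType ∧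
    PreservesMor B.toBirat (fun _ _ φ => S.IsCoAngular φ ∧ S.IsLinear φ) B.ops.IsPullbackMorphism ∧
    (∀ d, PreservesMor B.toBirat (S.HasDegree d) (B.ops.HasDegree d)) ∧
    PreservesMor B.toBirat ⊤ B.ops.IsIsometry ∧
    PreservesMor B.toBirat S.IsPreStep B.ops.IsPreStep ∧
    PreservesMor B.toBirat S.IsBaseIso B.ops.IsBaseIso ∧
    PreservesObj B.toBirat S.IsIsotropic B.ops.IsIsotropic

/-- **Definition 4.5 (i)**: `A` is *birationally Frobenius-normalized* if its image in `C^birat` is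
Frobenius-normalized (FrdI p. 86). [cite: MochizukiFrdI2008, Def. 4.5 (i) p.86] -/
def IsBiratFrobeniusNormalizedObj (A : C) : Prop := B.ops.IsFrobeniusNormalized (B.toBirat.obj A)

/-- **Definition 4.5 (i)**: `C` is *of birationally Frobenius-normalized type* if every object is
birationally Frobenius-normalized (FrdI p. 86); "model type" = pre-model (Def. 2.7, seat abc-iut-L1-t2)
and birationally Frobenius-normalized type. [cite: MochizukiFrdI2008, Def. 4.5 (i) p.86] -/
@[mk_iff] structure IsOfBiratFrobeniusNormalizedType : Prop where
  /-- every object is birationally Frobenius-normalized -/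
  obj : ∀ A : C, IsBiratFrobeniusNormalizedObj B A

/-- **Definition 4.5 (ii)**: `A` is *strictly rational* if for every prime `𝔭 ∈ Prime(Φ(A))` there is an
element `a - b ∈ Φ^birat(A)`, `a, b ∈ Φ(A)`, with `𝔭 ∈ Supp(a)`, `𝔭 ∉ Supp(b)` (FrdI p. 86; `Φ` perf-factorial).
`Φ^birat` is the `phiBirat` of the birationalization datum `B`; the support `Supp` of Def. 2.4 (i)(d) is a
§2 notion and enters as the parameter `Supp a 𝔭`. [cite: MochizukiFrdI2008, Def. 4.5 (ii) p.86] -/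
def IsStrictlyRational (Supp : ∀ {X : D}, S.Mon X → Primes (S.Mon X) → Prop) (A : C) : Prop :=
  ∀ 𝔭 : Primes (S.Mon (S.base.obj A)), ∃ a b : S.Mon (S.base.obj A),
    Algebra.GrothendieckGroup.of a / Algebra.GrothendieckGroup.of b ∈ B.phiBirat (S.base.obj A) ∧
      Supp a 𝔭 ∧ ¬ Supp b 𝔭

/-- **Definition 4.5 (ii)**: `A` is *rational* if some pull-back morphism `A' → A` has strictly rational
domain (FrdI p. 86). [cite: MochizukiFrdI2008, Def. 4.5 (ii) p.86] -/
def IsRational (Supp : ∀ {X : D}, S.Mon X → Primes (S.Mon X) → Prop) (A : C) : Prop :=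
  ∃ (A' : C) (φ : A' ⟶ A), S.IsPullbackMorphism φ ∧ IsStrictlyRational B Supp A'

/-- The parameters through which "rationally standard" (Def. 4.5 (iii)) is stated: a birationalization datum
of `C`, a support predicate on the divisor monoids (Def. 2.4 (i)(d), §2), and the operations + a
birationalization datum of the unit-trivialisation `C^un-tr` (data-only; to be instantiated with THE
constructions). [cite: MochizukiFrdI2008, Def. 4.5 (iii) p.86] -/
structure RSParams (S : PreFrobenioidData.{w} C D) where
  /-- `C^birat` -/
  B : BiratData.{w, v, v', u, u', vb} S
  /-- `Supp(a) ∋ 𝔭` on each `Φ(X)` -/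
  Supp : ∀ {X : D}, S.Mon X → Primes (S.Mon X) → Prop
  /-- the operations of `C^un-tr` over `D` -/
  SU : PreFrobenioidData.{w} S.Untr D
  /-- `(C^un-tr)^birat` -/
  BU : BiratData.{w, _, v', _, u', vb} SU

/-- **Definition 4.5 (iii)**: `C` is *of rationally standard type*: (a) birationally Frobenius-normalized,
rational and standard type; (b) `(C^un-tr)^birat` admits a Frobenius-compact object (FrdI p. 86) — over
the parameters `R : RSParams S`. [cite: MochizukiFrdI2008, Def. 4.5 (iii) p.86] -/
structure IsOfRationallyStandardType (S : PreFrobenioidData.{w} C D) (R : S.RSParams) : Prop where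
  /-- (a) birationally Frobenius-normalized type -/
  biratFrobNormalized : IsOfBiratFrobeniusNormalizedType R.B
  /-- (a) rational type -/
  rational : ∀ A : C, IsRational R.B R.Supp A
  /-- (a) standard type -/
  standard : S.IsOfStandardType
  /-- (b) `(C^un-tr)^birat` admits a Frobenius-compact object -/
  frobCompact : ∃ X : R.BU.Birat, R.BU.ops.IsFrobeniusCompact X

variable (S)

/-- **Definition 4.5 (iv)**: `D` is *Div-slim* (relative to `Φ`) if for every `A ∈ Ob(D)` the homomorphism
`Aut(D_A → D) → Aut(D_A → Mon)` induced by composing with `Φ` is injective: an automorphism of the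
forgetful functor `D_A → D` all of whose components act trivially on `Φ` is trivial (FrdI p. 86).
[cite: MochizukiFrdI2008, Def. 4.5 (iv) p.86] -/
@[mk_iff] structure IsDivSlim : Prop where
  /-- trivial action on `Φ` forces the automorphism of `D_A → D` to be trivial -/
  eq_one : ∀ (A : D) (α : Aut (Over.forget A)),
    (∀ (B : Over A) (x : S.Mon B.left), S.pull (α.hom.app B) x = x) → α = 1

/-- "[Thus, if `D` is slim, then it is Div-slim.]" (FrdI Def. 4.5 (iv) p. 86; PROVED).
[cite: MochizukiFrdI2008, Def. 4.5 (iv) p.86] -/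
theorem isDivSlim_of_isSlim (h : IsSlim D) : S.IsDivSlim :=
  ⟨fun A α _ => by
    have := h.isRigid_forget A α
    rw [this]; rfl⟩

/-- **Remark 4.5.1** (typed): if `C` is of standard type then so is `C^istr` — for the operations `SI` of
`C^istr` (the restriction of `S`) (FrdI p. 86; the rationally-standard half is analogous over the §2
parameters). [cite: MochizukiFrdI2008, Rem. 4.5.1 p.86] -/
def Remark451 (SI : PreFrobenioidData.{w} S.Istr D) : Prop := S.IsOfStandardType → SI.IsOfStandardType

/-- **Example 4.7 (i)**, first claim (PROVED): if `Φ` maps every automorphism of `D` to an identity, then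
`D` is Div-slim iff `D` is slim (FrdI p. 87). [cite: MochizukiFrdI2008, Ex. 4.7 (i) p.87] -/
theorem isDivSlim_iff_isSlim_of_trivial_on_aut
    (hΦ : ∀ (X : D) (f : X ⟶ X), IsIso f → ∀ x : S.Mon X, S.pull f x = x) :
    S.IsDivSlim ↔ IsSlim D := by
  refine ⟨fun h => ⟨fun A α => ?_⟩, S.isDivSlim_of_isSlim⟩
  exact h.eq_one A α fun B x => hΦ _ _ (inferInstance : IsIso (α.hom.app B)) x

/-! ### Proposition 4.8 (Birationalization of a Frobenioid II) -/

/-- **Proposition 4.8 (i)**: if `C` is of isotropic type, so is `C^birat` (FrdI p. 88).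
[cite: MochizukiFrdI2008, Prop. 4.8 (i) p.88] -/
def Prop48i : Prop := S.IsOfIsotropicType → B.ops.IsOfIsotropicType

/-- **Proposition 4.8 (ii)**: if `C` is of perfect and isotropic type, so is `C^birat` (FrdI p. 88).
[cite: MochizukiFrdI2008, Prop. 4.8 (ii) p.88] -/
def Prop48ii : Prop := S.IsOfPerfectType → S.IsOfIsotropicType → B.ops.IsOfPerfectType ∧ B.ops.IsOfIsotropicType

/-- **Proposition 4.8 (iii)**: if `C` is of rationally standard type then `(C^istr)^birat` is of standard
type — over birationalization data `BI` of `C^istr` (FrdI p. 88). [cite: MochizukiFrdI2008, Prop. 4.8 (iii) p.88] -/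
def Prop48iii (R : S.RSParams) (SI : PreFrobenioidData.{w} S.Istr D) (BI : SI.BiratData) : Prop :=
  S.IsOfRationallyStandardType R → BI.ops.IsOfStandardType

/-- **Proposition 4.8 (iv)**: if `C` is of isotropic and pre-model type, so is `C^birat` — "pre-model"
(Def. 2.7, seat abc-iut-L1-t2) as ONE predicate parameter `IsOfPreModelType` applied to both sides
(FrdI p. 88). [cite: MochizukiFrdI2008, Prop. 4.8 (iv) p.88] -/
def Prop48iv (IsOfPreModelType : ∀ {X : Type u} [Category.{v} X], PreFrobenioidData.{w} X D → Prop) : Prop :=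
  S.IsOfIsotropicType → IsOfPreModelType S → B.ops.IsOfIsotropicType ∧ IsOfPreModelType B.ops

end OneFrobenioid

/-! ### Theorem 4.2 (Category-theoreticity of primary steps) -/

section Thm42

variable {C₁ : Type u₁} [Category.{v₁} C₁] {D₁ : Type u₁'} [Category.{v₁'} D₁]
variable {C₂ : Type u₂} [Category.{v₂} C₂] {D₂ : Type u₂'} [Category.{v₂'} D₂]
variable (S₁ : PreFrobenioidData.{w₁} C₁ D₁) (S₂ : PreFrobenioidData.{w₂} C₂ D₂) (Ψ : C₁ ≌ C₂)

/-- The hypotheses of Thm. 4.2: `C_i` of standard and isotropic type, not of group-like type (and `Φ_i`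
perf-factorial, a §2 notion added by the wrapper) (FrdI p. 77). [cite: MochizukiFrdI2008, Thm. 4.2 p.77] -/
@[mk_iff] structure Thm42Setting : Prop where
  /-- standard type -/
  standard : S₁.IsOfStandardType ∧ S₂.IsOfStandardType
  /-- isotropic type -/
  isotropic : S₁.IsOfIsotropicType ∧ S₂.IsOfIsotropicType
  /-- not of group-like type -/
  notGroupLike : ¬ S₁.IsOfGroupLikeType ∧ ¬ S₂.IsOfGroupLikeType

/-- **Theorem 4.2 (i)**: `Ψ` preserves primary steps, Div-identity endomorphisms, Div-Frobenius-trivial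
objects and universally Div-Frobenius-trivial objects (FrdI p. 77). [cite: MochizukiFrdI2008, Thm. 4.2 (i) p.77] -/
def Thm42i : Prop :=
  Thm42Setting S₁ S₂ →
    PreservesMor Ψ.functor (fun _ _ φ => S₁.IsStep φ ∧ S₁.IsPrimaryPreStep φ)
        (fun _ _ φ => S₂.IsStep φ ∧ S₂.IsPrimaryPreStep φ) ∧
      (∀ (A : C₁) (α : A ⟶ A), S₁.IsDivIdentity α → S₂.IsDivIdentity (Ψ.functor.map α)) ∧
      PreservesObj Ψ.functor S₁.IsDivFrobeniusTrivial S₂.IsDivFrobeniusTrivial ∧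
      PreservesObj Ψ.functor S₁.IsUniversallyDivFrobeniusTrivial S₂.IsUniversallyDivFrobeniusTrivial

/-- **Theorem 4.2 (ii)**: there is a unique family of bijections `Ψ^Prime_A : Prime(Φ₁(A)) ≃ Prime(Φ₂(Ψ A))`
such that, for corresponding primes `𝔭₁ ↦ 𝔭₂`, the map induced by `Ψ` on co-angular pre-steps from `A`
(resp. to `A`) identifies those with zero divisor in `Φ₁(A)_{𝔭₁}` with those with zero divisor in
`Φ₂(Ψ A)_{𝔭₂}` — i.e. restricts to the equivalences `{^A C^coa-pre}_{𝔭₁} ≃ {^{ΨA} C^coa-pre}_{𝔭₂}`,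
`{C^coa-pre_A}_{𝔭₁} ≃ {C^coa-pre_{ΨA}}_{𝔭₂}` of the statement (FrdI pp. 77–78).
-- TODO(general form): the printed `Ψ^Prime` is an isomorphism of functors on `C^bs-iso`; naturality
-- in `A` along base-isomorphisms is not spelled out here. [cite: MochizukiFrdI2008, Thm. 4.2 (ii) p.77] -/
def Thm42ii : Prop :=
  Thm42Setting S₁ S₂ →
    ∃! e : ∀ A : C₁, Primes (S₁.Mon (S₁.base.obj A)) ≃ Primes (S₂.Mon (S₂.base.obj (Ψ.functor.obj A))),
      ∀ (A : C₁) (𝔭 : Primes (S₁.Mon (S₁.base.obj A))),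
        (∀ ⦃B : C₁⦄ (φ : A ⟶ B), S₁.IsCoAngularPreStep φ →
            (S₁.div φ ∈ 𝔭.submonoid ↔ S₂.div (Ψ.functor.map φ) ∈ (e A 𝔭).submonoid)) ∧
        ∀ ⦃B : C₁⦄ (ψ : B ⟶ A), S₁.IsCoAngularPreStep ψ →
          ((∃ y ∈ 𝔭.submonoid, S₁.pull (S₁.base.map ψ) y = S₁.div ψ) ↔
            ∃ y ∈ (e A 𝔭).submonoid, S₂.pull (S₂.base.map (Ψ.functor.map ψ)) y = S₂.div (Ψ.functor.map ψ))

/-- **Theorem 4.2 (iii)**: if `A` is Div-Frobenius-trivial, the two equivalences of (ii) arise from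
isomorphisms of monoids `Φ₁(A)_{𝔭₁} ≃ Φ₂(Ψ A)_{𝔭₂}` — the *right-hand* one computing the divisors of the
images of co-angular pre-steps out of `A`, the *left-hand* one those (through `Base^*`) of co-angular
pre-steps into `A` (FrdI p. 78). [cite: MochizukiFrdI2008, Thm. 4.2 (iii) p.78] -/
def Thm42iii (e : ∀ A : C₁, Primes (S₁.Mon (S₁.base.obj A)) ≃ Primes (S₂.Mon (S₂.base.obj (Ψ.functor.obj A)))) :
    Prop :=
  Thm42Setting S₁ S₂ → ∀ (A : C₁), S₁.IsDivFrobeniusTrivial A → ∀ 𝔭 : Primes (S₁.Mon (S₁.base.obj A)),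
    (∃ r : 𝔭.submonoid ≃* (e A 𝔭).submonoid, ∀ ⦃B : C₁⦄ (φ : A ⟶ B), S₁.IsCoAngularPreStep φ →
        ∀ h : S₁.div φ ∈ 𝔭.submonoid, (r ⟨S₁.div φ, h⟩ : S₂.Mon _) = S₂.div (Ψ.functor.map φ)) ∧
    ∃ l : 𝔭.submonoid ≃* (e A 𝔭).submonoid, ∀ ⦃B : C₁⦄ (ψ : B ⟶ A), S₁.IsCoAngularPreStep ψ →
        ∀ (y : S₁.Mon (S₁.base.obj A)) (h : y ∈ 𝔭.submonoid), S₁.pull (S₁.base.map ψ) y = S₁.div ψ →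
          S₂.pull (S₂.base.map (Ψ.functor.map ψ)) (l ⟨y, h⟩ : S₂.Mon _) = S₂.div (Ψ.functor.map ψ)

end Thm42

end PreFrobenioidData

end Literature.AlgebraicGeometry.Frobenioids
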